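import Summits.CriticalPhenomena.PercolationContinuityZ3.Theorems.PercAnnulusCrossingNoiseStable
import Summits.CriticalPhenomena.PercolationContinuityZ3.Theorems.PercAnnulusCrossingNoiseLowDegree
import Summits.CriticalPhenomena.PercolationContinuityZ3.Theorems.PercAnnulusCrossingNoiseBoxCross
import Summits.CriticalPhenomena.PercolationContinuityZ3.Theorems.PercAnnulusCrossingOSSSUpper
import HarnessLib

/-!
# RSW3 lane (lead, gen 21): THE SPECTRAL SAMPLE OF A CROSSING, IV — crossings of graphs and Kesten's boxes (every `d`, `L`, `i`, `p`):
# MEAN SPECTRAL SIZE = `p(1−p)·E[N_piv]`, NOISE STABILITY BELOW THE PIVOTAL SCALE, DECORRELATION FROM EDGE COUNTS AND LOCAL STATISTICS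

builds on p205010 (kernel theorem, internal audit signed; external expert review pending) — NOT used in this file (every `p`, every `d`).

Cell `prim-rsw3` (LANE 3), lead seat, gen 21.  Support file (`--supports stmt-CriticalPhenomena-4575`); no definitions, no named facts,
no sorries.  Setting of gen 19/20 (`…OSSSBlock`, `…OSSSBoxCross`, `…OSSSUpper`, `…NoiseBoxCross`): the block `{0..L} ⊆ Λ(N)` read on the box cube
of `Λ(N)` (all pairs as coordinates, bias `p` on lattice edges, `0` elsewhere), block incidence and hyperplane seed sets written inline;
`P = P_p(boxCross L i)`, `ℓ = L_i⁺`, `S = S_{ℓ+1}(p) = Σ_{j≤ℓ} π_p(j)`, `D' = Σ_{z ⊆ Λ(N)} P_p(z ∈ E(ℤ^d), z pivotal for boxCross L i) = E_p[N_piv]`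
(Russo), `δ = 4S/(ℓ+1)` the mixed revealment of the uniform hyperplane.  Proved:

* §1 GRAPHS (`𝟙 = 𝟙{X ↔ B}` on a finite edge-labelled graph, biases in `[0,1]^E`): `sq_sub_gcross_update_eq` (`(D_e𝟙)² = D_e𝟙`),
  **`mean_spectral_size_gcross_eq`** (`Σ_S |S|·𝟙̂(S)² = Σ_e p_e(1−p_e)·P(e pivotal)` — the mean size of the spectral sample of a crossing is its
  `p(1−p)`-weighted expected pivotal count), `ne_indicator_eq_sq_sub`, **`flip_gcross_le`** (`P(𝟙(ω) ≠ 𝟙(ω^ε)) ≤ 2ε·Σ_e p_e(1−p_e)·P(e pivotal)`).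
* §2 KESTEN'S BOXES: **`boxCross_mean_spectral_size_eq`** (`Σ_S |S|·𝟙̂_{boxCross}(S)² = p(1−p)·D'`); **`boxCross_high_level_weight_le`**
  (`M·Σ_{|S|≥M} 𝟙̂(S)² ≤ p(1−p)·D'` — with gen 20's `(ℓ+1)Σ_{|S|=k} ≤ 4kS·P` the spectral sample of a box crossing lives on the levels between
  `((ℓ+1)/S)^{1/2}` and `p(1−p)E[N_piv]`); **`boxCross_flip_le`** (`P_p(an ε-noise changes 𝟙_{boxCross}) ≤ 2ε·p(1−p)·D'`) and, with gen 19's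
  O'Donnell–Servedio ceiling, **`boxCross_flip_le_sqrt`** (`≤ 2ε·√(8d·#{0..L}·S·p(1−p)·P(1−P)/(ℓ+1))`);
  **`boxCross_abs_cov_linear_le`** (`|Cov_p(𝟙_{boxCross}, Σ_e a_e ω_e)| ≤ √(δ·P)·√(Σ_e a_e² b_e(1−b_e))` for every weight vector on the pairs of
  `Λ(N)` — THE CROSSING IS NEARLY UNCORRELATED WITH EVERY WEIGHTED EDGE COUNT); **`boxCross_abs_cov_local_le`** (every sum `G` of `k`-local
  statistics: `|Cov_p(𝟙_{boxCross}, G)| ≤ k·√(δ·P)·σ(G)`).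
* §3 THE CUBE OF `ℤ³` (every `n`, `p`): `cube_flip_le` (`≤ 2ε·p(1−p)·E_p[N_piv(n)]`), **`cube_flip_le_sqrt`**
  (`≤ 2ε·(n+1)·√(24·S_{n+1}(p)·p(1−p)·Π_p(n)(1−Π_p(n)))`, so `≤ √6·ε·(n+1)^{3/2}` always), `cube_abs_cov_linear_le`, `cube_abs_cov_local_le`.

So an ε-noise of strength `ε ≪ 1/E_p[N_piv]` does not change the crossing (this file), while (gen 20) one of strength `ε ≫ √δ` decorrelates it:
the noise-sensitivity scale of a box crossing is bracketed by its pivotal count and its revealment, at every `p`.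

References: C. Garban, G. Pete, O. Schramm, Acta Math. 205 (2010) Thm 1.1, §1 (spectral sample vs pivotals for planar crossings); I. Benjamini,
G. Kalai, O. Schramm, Publ. IHÉS 90 (1999) §1.3 Thm 1.7, §1.4; R. O'Donnell, CUP 2014, Thm 2.38, Prop 3.2, Ex. 2.42, Prop 8.45; O. Schramm,
J. Steif, Ann. of Math. 171 (2010) Thm 1.8; L. Russo, Z. Wahrsch. 56 (1981); H. Kesten (1982) §3.3.
-/

noncomputable section

/-! ## §1 Graphs: mean spectral size and noise stability of `𝟙{X ↔ B}` -/

namespace Summit.CriticalPhenomena.PercolationContinuityZ3.Theorems.Crossing.Spectral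

open Finset Function
open Literature.Probability.Percolation
open Literature.Probability.ODonnellSaksSchrammServedio2005
open Literature.Probability.Percolation.GhostExploration Literature.Probability.Percolation.SeedExploration

variable {W E : Type*} {edge : W → W → Option E} [Fintype E] [DecidableEq E]

omit [Fintype E] in
/-- `(𝟙(y^{e→1}) − 𝟙(y^{e→0}))² = 𝟙(y^{e→1}) − 𝟙(y^{e→0})` (a 0/1-valued increasing function: the difference is the indicator that `e` is pivotal).
[cite: GarbanSteif2014, Ch. I Def I.2–I.4 (pivotality and influence)] -/
theorem sq_sub_gcross_update_eq (X B : Set W) (y : E → Bool) (e : E) :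
    (gcross edge X B (update y e true) - gcross edge X B (update y e false)) ^ 2
      = gcross edge X B (update y e true) - gcross edge X B (update y e false) := by
  have hle := gcross_update_false_le (edge := edge) X B y e
  rcases gcross_mem edge X B (update y e true) with h1 | h1 <;>
    rcases gcross_mem edge X B (update y e false) with h0 | h0
  · rw [h1, h0]; norm_num
  · rw [h1, h0] at hle; norm_num at hle
  · rw [h1, h0]; norm_num
  · rw [h1, h0]; norm_num

/-- **THE MEAN SIZE OF THE SPECTRAL SAMPLE OF A CROSSING IS ITS WEIGHTED PIVOTAL COUNT** (every finite edge-labelled graph, biases in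
`[0,1]^E`; p-biased characters written out): `Σ_S |S|·𝟙̂{X↔B}(S)² = Σ_e p_e(1−p_e)·P(e pivotal for {X↔B})`.
[cite: GarbanPeteSchramm2010, §1 (E|𝒮| = E|𝒫| via the level-|S| identity)] [cite: ODonnell2014, Thm 2.38 and Prop 8.45 (I[f] = Σ_S |S| f̂(S)² = σ² E[sens_f])] -/
theorem mean_spectral_size_gcross_eq (p : E → ℝ) (h0 : ∀ e, 0 ≤ p e) (h1 : ∀ e, p e ≤ 1) (X B : Set W) :
    ∑ S ∈ (Finset.univ : Finset E).powerset, (S.card : ℝ)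
        * (∑ x : E → Bool, wt p x * (gcross edge X B x * ∏ e ∈ S, (((if x e then (1 : ℝ) else 0) - p e) / Real.sqrt (p e * (1 - p e))))) ^ 2
      = ∑ e, p e * (1 - p e) * pivCross edge p X B e := by
  rw [← sum_bias_mul_sum_sq_eq_sum_card_mul_coeff_sq (pbiased_H1 p) (pbiased_H2 p h0 h1) (gcross edge X B)]
  refine Finset.sum_congr rfl fun e _ => ?_
  unfold pivCross
  simp only [sq_sub_gcross_update_eq]

omit [Fintype E] [DecidableEq E] in
/-- For 0/1-valued functions the flip indicator is the squared difference: `𝟙[𝟙(x) ≠ 𝟙(x')] = (𝟙(x) − 𝟙(x'))²`.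
[cite: BenjaminiKalaiSchramm1999, §1.4 (P[𝒜 Δ N_ε𝒜])] -/
theorem ne_indicator_eq_sq_sub (X B : Set W) (x x' : E → Bool) :
    (if gcross edge X B x ≠ gcross edge X B x' then (1 : ℝ) else 0) = (gcross edge X B x - gcross edge X B x') ^ 2 := by
  rcases gcross_mem edge X B x with h | h <;> rcases gcross_mem edge X B x' with h' | h' <;> simp [h, h']

/-- **NOISE STABILITY OF A CROSSING BELOW ITS PIVOTAL SCALE** (every finite edge-labelled graph, biases in `[0,1]^E`, `0 ≤ ε ≤ 1`): the probability
that resampling each edge independently with probability `ε` changes `𝟙{X ↔ B}` is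
**`P(𝟙(ω) ≠ 𝟙(ω^ε)) ≤ 2ε·Σ_e p_e(1−p_e)·P(e pivotal)`** (no exploration, no revealment: part II's `E[(f − f^ε)²] ≤ 2ε·I(f)`).
[cite: BenjaminiKalaiSchramm1999, §1.4 (stability)] [cite: ODonnell2014, §2.4 Ex. 2.42 (NS_δ[f] ≤ δ I[f])] [cite: GarbanPeteSchramm2010, Thm 1.1 (the sharp planar statement)] -/
theorem flip_gcross_le (p : E → ℝ) (h0 : ∀ e, 0 ≤ p e) (h1 : ∀ e, p e ≤ 1) (X B : Set W) {ε : ℝ} (hε0 : 0 ≤ ε) (hε1 : ε ≤ 1) :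
    ∑ x : E → Bool, ∑ y : E → Bool, ∑ m : E → Bool, wt p x * wt p y * wt (fun _ => ε) m
        * (if gcross edge X B x ≠ gcross edge X B (fun e => if m e = true then y e else x e) then (1 : ℝ) else 0)
      ≤ 2 * ε * ∑ e, p e * (1 - p e) * pivCross edge p X B e := by
  simp only [ne_indicator_eq_sq_sub]
  refine (noise_sq_sub_le_total_influence p h0 h1 (gcross edge X B) hε0 hε1).trans (le_of_eq ?_)
  congr 1
  refine Finset.sum_congr rfl fun e _ => ?_
  unfold pivCross
  simp only [sq_sub_gcross_update_eq]

end Summit.CriticalPhenomena.PercolationContinuityZ3.Theorems.Crossing.Spectral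

/-! ## §2 Kesten's box crossings `boxCross L i` -/

namespace Summit.CriticalPhenomena.PercolationContinuityZ3.Theorems.Crossing

open MeasureTheory Finset Function
open Literature.Probability.Percolation Literature.Probability.LatticeModels
open Literature.Probability.ODonnellSaksSchrammServedio2005
open Literature.Probability.ODonnellSaksSchrammServedio2005.Strategy
open Literature.Probability.Percolation.GhostExploration Literature.Probability.Percolation.SeedExploration
open Literature.Probability.Percolation.OneArmOSSS Literature.Probability.Percolation.DCT16
open Summit.CriticalPhenomena.PercolationContinuityZ3.Theorems.SurfaceTension
open Summit.CriticalPhenomena.PercolationContinuityZ3.Theorems.CrossingRevealment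
open Summit.CriticalPhenomena.PercolationContinuityZ3.Theorems.Crossing.Spectral

variable {d : ℕ} (L : Site d) (i : Fin d) (N : ℕ) (hLN : Finset.Icc (0 : Site d) L ⊆ box d N) (p : unitInterval)

include hLN in
/-- The `b_e(1−b_e)`-weighted cube pivotal count of the block crossing is `p(1−p)·Σ_{z ⊆ Λ(N)} P_p(z ∈ E(ℤ^d), z pivotal for boxCross L i)`
(`= p(1−p)·E_p[N_piv]` by linearity). [cite: RussoZW1981, §4 Lemma 3 (4.2)] -/
theorem sum_bias_mul_pivCross_hyperplanes_eq :
    ∑ e : PairIdx d N, boxBias d N p e * (1 - boxBias d N p e) * pivCross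
        (fun a b : BoxV d N => if a.1 ∈ Icc 0 L ∧ b.1 ∈ Icc 0 L then latEdge d N a b else none) (boxBias d N p)
        {v : BoxV d N | v.1 ∈ Icc 0 L ∧ v.1 i = 0} {v : BoxV d N | v.1 ∈ Icc 0 L ∧ v.1 i = L i} e
      = ((p : ℝ) * (1 - p)) * ∑ z ∈ (box d N).sym2, (bondPercolation (zdGraph d) p).real
          {ω | z ∈ (zdGraph d).edgeSet ∧ IsPivotal (boxCross L i) z ω} := by
  classical
  simp only [bias_mul_pivCross_hyperplanes_eq L i N hLN p]
  rw [← Finset.mul_sum, ← Finset.sum_coe_sort (box d N).sym2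
    (fun z => (bondPercolation (zdGraph d) p).real {ω | z ∈ (zdGraph d).edgeSet ∧ IsPivotal (boxCross L i) z ω})]

include hLN in
/-- **THE MEAN SIZE OF THE SPECTRAL SAMPLE OF A BOX CROSSING IS `p(1−p)·E_p[N_piv]`** (every `d`, `L`, `i`, `p`; on the box cube of `Λ(N) ⊇ {0..L}`,
p-biased characters with bias `b = boxBias` written out): `Σ_S |S|·𝟙̂_{boxCross}(S)² = p(1−p)·Σ_{z ⊆ Λ(N)} P_p(z ∈ E(ℤ^d), z pivotal for boxCross L i)`.
[cite: GarbanPeteSchramm2010, §1 and Thm 1.1 (|𝒮| vs |𝒫| for crossings)] [cite: ODonnell2014, Thm 2.38 / Prop 8.45] -/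
theorem boxCross_mean_spectral_size_eq :
    ∑ S ∈ (Finset.univ : Finset (PairIdx d N)).powerset, (S.card : ℝ)
        * (∑ x : PairIdx d N → Bool, wt (boxBias d N p) x * (gcross
            (fun a b : BoxV d N => if a.1 ∈ Icc 0 L ∧ b.1 ∈ Icc 0 L then latEdge d N a b else none)
            {v : BoxV d N | v.1 ∈ Icc 0 L ∧ v.1 i = 0} {v : BoxV d N | v.1 ∈ Icc 0 L ∧ v.1 i = L i} x
          * ∏ e ∈ S, (((if x e then (1 : ℝ) else 0) - boxBias d N p e) / Real.sqrt (boxBias d N p e * (1 - boxBias d N p e))))) ^ 2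
      = ((p : ℝ) * (1 - p)) * ∑ z ∈ (box d N).sym2, (bondPercolation (zdGraph d) p).real
          {ω | z ∈ (zdGraph d).edgeSet ∧ IsPivotal (boxCross L i) z ω} := by
  rw [mean_spectral_size_gcross_eq (boxBias d N p) (boxBias_nonneg N p.2.1) (boxBias_le_one N p.2.2),
    sum_bias_mul_pivCross_hyperplanes_eq L i N hLN p]

include hLN in
/-- **MARKOV ON THE SPECTRAL SAMPLE OF A BOX CROSSING**: for every `M`, `M·Σ_{|S| ≥ M} 𝟙̂_{boxCross}(S)² ≤ p(1−p)·E_p[N_piv]` — the crossing carries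
Fourier weight at most `p(1−p)E[N_piv]/M` above level `M` (with gen 20's `(ℓ+1)·Σ_{|S|=k} 𝟙̂(S)² ≤ 4kS·P` below: the spectral sample of a box
crossing lives between the levels `≈ ((ℓ+1)/S)^{1/2}` and `≈ p(1−p)E[N_piv]`).
[cite: ODonnell2014, §3.1 Prop 3.2 (ε-concentration up to degree I[f]/ε)] [cite: GarbanPeteSchramm2010, Thm 1.1 (the planar spectral sample is concentrated at E|𝒫|)] -/
theorem boxCross_high_level_weight_le (M : ℕ) :
    (M : ℝ) * ∑ S ∈ (Finset.univ : Finset (PairIdx d N)).powerset.filter (fun S => M ≤ S.card),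
        (∑ x : PairIdx d N → Bool, wt (boxBias d N p) x * (gcross
            (fun a b : BoxV d N => if a.1 ∈ Icc 0 L ∧ b.1 ∈ Icc 0 L then latEdge d N a b else none)
            {v : BoxV d N | v.1 ∈ Icc 0 L ∧ v.1 i = 0} {v : BoxV d N | v.1 ∈ Icc 0 L ∧ v.1 i = L i} x
          * ∏ e ∈ S, (((if x e then (1 : ℝ) else 0) - boxBias d N p e) / Real.sqrt (boxBias d N p e * (1 - boxBias d N p e))))) ^ 2
      ≤ ((p : ℝ) * (1 - p)) * ∑ z ∈ (box d N).sym2, (bondPercolation (zdGraph d) p).real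
          {ω | z ∈ (zdGraph d).edgeSet ∧ IsPivotal (boxCross L i) z ω} := by
  rw [← boxCross_mean_spectral_size_eq L i N hLN p]
  exact mul_high_level_weight_le _ (fun S => sq_nonneg _) M

include hLN in
/-- **NOISE STABILITY OF A BOX CROSSING BELOW THE PIVOTAL SCALE** (every `d`, `L`, `i`, `p`, `0 ≤ ε ≤ 1`): with `ω ~ P_p` read on the box cube of
`Λ(N) ⊇ {0..L}` and `ω^ε` its ε-noised copy (each pair of `Λ(N)` independently resampled with probability `ε`),
**`P(𝟙_{boxCross L i}(ω) ≠ 𝟙_{boxCross L i}(ω^ε)) ≤ 2ε·p(1−p)·Σ_{z ⊆ Λ(N)} P_p(z ∈ E(ℤ^d), z pivotal) = 2ε·p(1−p)·E_p[N_piv]`** (finite-sum form).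
[cite: BenjaminiKalaiSchramm1999, §1.4 (stability of events)] [cite: ODonnell2014, §2.4 Ex. 2.42] [cite: GarbanPeteSchramm2010, Thm 1.1] -/
theorem boxCross_flip_le {ε : ℝ} (hε0 : 0 ≤ ε) (hε1 : ε ≤ 1) :
    ∑ x : PairIdx d N → Bool, ∑ y : PairIdx d N → Bool, ∑ m : PairIdx d N → Bool,
        wt (boxBias d N p) x * wt (boxBias d N p) y * wt (fun _ => ε) m
        * (if gcross (fun a b : BoxV d N => if a.1 ∈ Icc 0 L ∧ b.1 ∈ Icc 0 L then latEdge d N a b else none)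
              {v : BoxV d N | v.1 ∈ Icc 0 L ∧ v.1 i = 0} {v : BoxV d N | v.1 ∈ Icc 0 L ∧ v.1 i = L i} x
            ≠ gcross (fun a b : BoxV d N => if a.1 ∈ Icc 0 L ∧ b.1 ∈ Icc 0 L then latEdge d N a b else none)
              {v : BoxV d N | v.1 ∈ Icc 0 L ∧ v.1 i = 0} {v : BoxV d N | v.1 ∈ Icc 0 L ∧ v.1 i = L i}
              (fun e => if m e = true then y e else x e) then (1 : ℝ) else 0)
      ≤ 2 * ε * (((p : ℝ) * (1 - p)) * ∑ z ∈ (box d N).sym2, (bondPercolation (zdGraph d) p).real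
          {ω | z ∈ (zdGraph d).edgeSet ∧ IsPivotal (boxCross L i) z ω}) := by
  rw [← sum_bias_mul_pivCross_hyperplanes_eq L i N hLN p]
  exact flip_gcross_le (boxBias d N p) (boxBias_nonneg N p.2.1) (boxBias_le_one N p.2.2) _ _ hε0 hε1

include hLN in
/-- **THE SAME AGAINST THE ONE-ARM CESÀRO SUM** (gen 19's O'Donnell–Servedio ceiling `(ℓ+1)·p(1−p)·E[N_piv]² ≤ 8d·#{0..L}·S·P(1−P)`):
`P(𝟙_{boxCross}(ω) ≠ 𝟙_{boxCross}(ω^ε)) ≤ 2ε·√(8d·#{0..L}·S_{ℓ+1}(p)·p(1−p)·P(1−P)/(ℓ+1))`, every `d`, `L`, `i`, `p`, `0 ≤ ε ≤ 1`.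
[cite: DewanMuirhead2022, Prop. 2.2 / 2.10 (the O'Donnell–Servedio bound on Σ influences)] [cite: ODonnell2014, §2.4 Ex. 2.42] -/
theorem boxCross_flip_le_sqrt {ε : ℝ} (hε0 : 0 ≤ ε) (hε1 : ε ≤ 1) :
    ∑ x : PairIdx d N → Bool, ∑ y : PairIdx d N → Bool, ∑ m : PairIdx d N → Bool,
        wt (boxBias d N p) x * wt (boxBias d N p) y * wt (fun _ => ε) m
        * (if gcross (fun a b : BoxV d N => if a.1 ∈ Icc 0 L ∧ b.1 ∈ Icc 0 L then latEdge d N a b else none)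
              {v : BoxV d N | v.1 ∈ Icc 0 L ∧ v.1 i = 0} {v : BoxV d N | v.1 ∈ Icc 0 L ∧ v.1 i = L i} x
            ≠ gcross (fun a b : BoxV d N => if a.1 ∈ Icc 0 L ∧ b.1 ∈ Icc 0 L then latEdge d N a b else none)
              {v : BoxV d N | v.1 ∈ Icc 0 L ∧ v.1 i = 0} {v : BoxV d N | v.1 ∈ Icc 0 L ∧ v.1 i = L i}
              (fun e => if m e = true then y e else x e) then (1 : ℝ) else 0)
      ≤ 2 * ε * Real.sqrt (8 * d * ((Finset.Icc (0 : Site d) L).card : ℝ) * (∑ j ∈ Finset.range ((L i).toNat + 1), oneArmProb d p j)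
          * ((p : ℝ) * (1 - p)) * (boxCrossProb d p L i * (1 - boxCrossProb d p L i)) / ((((L i).toNat + 1 : ℕ)) : ℝ)) := by
  refine (boxCross_flip_le L i N hLN p hε0 hε1).trans (mul_le_mul_of_nonneg_left ?_ (by positivity))
  -- `p(1−p)D' ≤ √(8d#S·p(1−p)·V/(ℓ+1))` from `(ℓ+1)p(1−p)D'² ≤ 8d#SV`
  set D' : ℝ := ∑ z ∈ (box d N).sym2, (bondPercolation (zdGraph d) p).real
    {ω | z ∈ (zdGraph d).edgeSet ∧ IsPivotal (boxCross L i) z ω} with hD'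
  have hceil := mul_sq_sum_pivotal_boxCross_le L i N hLN p
  rw [← hD'] at hceil
  have hq0 : 0 ≤ (p : ℝ) * (1 - p) := mul_nonneg p.2.1 (sub_nonneg.2 p.2.2)
  have hD0 : 0 ≤ D' := Finset.sum_nonneg fun z _ => measureReal_nonneg
  have hℓ : (0 : ℝ) < (((L i).toNat + 1 : ℕ) : ℝ) := by positivity
  refine Real.le_sqrt_of_sq_le ?_
  rw [le_div_iff₀ hℓ]
  calc ((p : ℝ) * (1 - p) * D') ^ 2 * ((((L i).toNat + 1 : ℕ)) : ℝ)
      = ((p : ℝ) * (1 - p)) * (((((L i).toNat + 1 : ℕ)) : ℝ) * (((p : ℝ) * (1 - p)) * D' ^ 2)) := by ring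
    _ ≤ ((p : ℝ) * (1 - p)) * (8 * d * ((Finset.Icc (0 : Site d) L).card : ℝ) * (∑ j ∈ Finset.range ((L i).toNat + 1), oneArmProb d p j)
          * (boxCrossProb d p L i * (1 - boxCrossProb d p L i))) := mul_le_mul_of_nonneg_left hceil hq0
    _ = _ := by ring

include hLN in
/-- **A BOX CROSSING IS NEARLY UNCORRELATED WITH EVERY WEIGHTED EDGE COUNT** (every `d`, `L`, `i`, `p`; every weight vector `a` on the pairs of
`Λ(N)`, `b = boxBias` = `p` on lattice edges and `0` elsewhere):
**`|E_p[𝟙_{boxCross}·Σ_e a_e(𝟙[ω_e] − b_e)]| ≤ √((4S_{ℓ+1}(p)/(ℓ+1))·P)·√(Σ_e a_e²·b_e(1−b_e))`** — the covariance with any weighted number of open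
edges is at most `√(δP)` standard deviations of the count (BKS's weighted majorities, in their linear form).
[cite: BenjaminiKalaiSchramm1999, §1.3 Thm 1.7] [cite: SchrammSteif2010, Thm 1.8 (k = 1), §4] -/
theorem boxCross_abs_cov_linear_le (a : PairIdx d N → ℝ) :
    |∑ x : PairIdx d N → Bool, wt (boxBias d N p) x * (gcross
          (fun a b : BoxV d N => if a.1 ∈ Icc 0 L ∧ b.1 ∈ Icc 0 L then latEdge d N a b else none)
          {v : BoxV d N | v.1 ∈ Icc 0 L ∧ v.1 i = 0} {v : BoxV d N | v.1 ∈ Icc 0 L ∧ v.1 i = L i} x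
        * ∑ e, a e * ctr (boxBias d N p) e x)|
      ≤ Real.sqrt ((4 * (∑ j ∈ Finset.range ((L i).toNat + 1), oneArmProb d p j) / ((((L i).toNat + 1 : ℕ)) : ℝ)) * boxCrossProb d p L i)
        * Real.sqrt (∑ e, a e ^ 2 * (boxBias d N p e * (1 - boxBias d N p e))) := by
  classical
  set ℓ : ℕ := (L i).toNat with hℓ
  have h := abs_cov_gcross_linear_le (edge := fun a b : BoxV d N => if a.1 ∈ Icc 0 L ∧ b.1 ∈ Icc 0 L then latEdge d N a b else none)
    (blockEdge_symm L N) (blockEdge_ends L N) (boxBias d N p) (boxBias_nonneg N p.2.1) (boxBias_le_one N p.2.2)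
    (X := {v : BoxV d N | v.1 ∈ Icc 0 L ∧ v.1 i = 0}) (B := {v : BoxV d N | v.1 ∈ Icc 0 L ∧ v.1 i = L i})
    (fun s : Fin (ℓ + 1) => {v : BoxV d N | v.1 ∈ Icc 0 L ∧ v.1 i = ((s : ℕ) : ℤ)}) (hyperplanes_separate L i N)
    (fun _ => 1 / ((ℓ + 1 : ℕ) : ℝ)) (fun _ => by positivity) (by rw [Finset.sum_const, Finset.card_univ, Fintype.card_fin, nsmul_eq_mul]; field_simp)
    (δ := 4 * (∑ j ∈ Finset.range (ℓ + 1), oneArmProb d p j) / ((ℓ + 1 : ℕ) : ℝ))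
    (div_nonneg (mul_nonneg (by norm_num) (Finset.sum_nonneg fun _ _ => measureReal_nonneg)) (Nat.cast_nonneg _))
    (fun e a b hab => sum_seedProb_hyperplanes_le L i N p e a b hab) a
  rw [sum_wt_gcross_hyperplanes_eq L i N hLN p] at h
  exact h

include hLN in
/-- **A BOX CROSSING IS NEARLY UNCORRELATED WITH EVERY LOCAL STATISTIC** (every `d`, `L`, `i`, `p`): for every finite sum `G = Σ_t g_t` of
`k`-local functions of the pairs of `Λ(N)` (each `g_t` reads at most `k` pairs — e.g. counts of local patterns of open edges),
**`|E_p[𝟙_{boxCross}·G] − P·E_p[G]| ≤ k·√((4S_{ℓ+1}(p)/(ℓ+1))·P)·√(E_p[G²] − E_p[G]²)`**.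
[cite: SchrammSteif2010, Thm 1.8] [cite: BenjaminiKalaiSchramm1999, Thm 1.9 (low levels)] -/
theorem boxCross_abs_cov_local_le {τ : Type*} [Fintype τ] {k : ℕ} (M : τ → Finset (PairIdx d N)) (hM : ∀ t, (M t).card ≤ k)
    (g : τ → (PairIdx d N → Bool) → ℝ) (hg : ∀ t x e c, e ∉ M t → g t (update x e c) = g t x) :
    |(∑ x : PairIdx d N → Bool, wt (boxBias d N p) x * (gcross
          (fun a b : BoxV d N => if a.1 ∈ Icc 0 L ∧ b.1 ∈ Icc 0 L then latEdge d N a b else none)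
          {v : BoxV d N | v.1 ∈ Icc 0 L ∧ v.1 i = 0} {v : BoxV d N | v.1 ∈ Icc 0 L ∧ v.1 i = L i} x * ∑ t, g t x))
        - boxCrossProb d p L i * (∑ x : PairIdx d N → Bool, wt (boxBias d N p) x * ∑ t, g t x)|
      ≤ k * Real.sqrt ((4 * (∑ j ∈ Finset.range ((L i).toNat + 1), oneArmProb d p j) / ((((L i).toNat + 1 : ℕ)) : ℝ)) * boxCrossProb d p L i)
        * Real.sqrt ((∑ x : PairIdx d N → Bool, wt (boxBias d N p) x * ((∑ t, g t x) * ∑ t, g t x))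
            - (∑ x : PairIdx d N → Bool, wt (boxBias d N p) x * ∑ t, g t x) ^ 2) := by
  classical
  set ℓ : ℕ := (L i).toNat with hℓ
  have h := abs_cov_gcross_le_of_local_sum (edge := fun a b : BoxV d N => if a.1 ∈ Icc 0 L ∧ b.1 ∈ Icc 0 L then latEdge d N a b else none)
    (blockEdge_symm L N) (blockEdge_ends L N) (boxBias d N p) (boxBias_nonneg N p.2.1) (boxBias_le_one N p.2.2)
    (X := {v : BoxV d N | v.1 ∈ Icc 0 L ∧ v.1 i = 0}) (B := {v : BoxV d N | v.1 ∈ Icc 0 L ∧ v.1 i = L i})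
    (fun s : Fin (ℓ + 1) => {v : BoxV d N | v.1 ∈ Icc 0 L ∧ v.1 i = ((s : ℕ) : ℤ)}) (hyperplanes_separate L i N)
    (fun _ => 1 / ((ℓ + 1 : ℕ) : ℝ)) (fun _ => by positivity) (by rw [Finset.sum_const, Finset.card_univ, Fintype.card_fin, nsmul_eq_mul]; field_simp)
    (δ := 4 * (∑ j ∈ Finset.range (ℓ + 1), oneArmProb d p j) / ((ℓ + 1 : ℕ) : ℝ))
    (div_nonneg (mul_nonneg (by norm_num) (Finset.sum_nonneg fun _ _ => measureReal_nonneg)) (Nat.cast_nonneg _))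
    (fun e a b hab => sum_seedProb_hyperplanes_le L i N p e a b hab) M hM g hg
  rw [sum_wt_gcross_hyperplanes_eq L i N hLN p] at h
  exact h

/-! ## §3 The cube `{0..n}³` of `ℤ³` (every `n`, `p`) -/

/-- **NOISE STABILITY OF THE CUBE CROSSING BELOW THE PIVOTAL SCALE** (`ℤ³`, every `n`, `p`, `0 ≤ ε ≤ 1`):
`P_p(𝟙_n(ω) ≠ 𝟙_n(ω^ε)) ≤ 2ε·p(1−p)·E_p[N_piv(n)]` (`E_p[N_piv(n)] = Σ_{z ⊆ Λ(n)} P_p(z ∈ E(ℤ³), z pivotal) = Π_n′(p)` by Russo).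
[cite: BenjaminiKalaiSchramm1999, §1.4] [cite: ODonnell2014, §2.4 Ex. 2.42] [cite: GarbanPeteSchramm2010, Thm 1.1] -/
theorem cube_flip_le (n : ℕ) (p : unitInterval) {ε : ℝ} (hε0 : 0 ≤ ε) (hε1 : ε ≤ 1) :
    ∑ x : PairIdx 3 n → Bool, ∑ y : PairIdx 3 n → Bool, ∑ m : PairIdx 3 n → Bool,
        wt (boxBias 3 n p) x * wt (boxBias 3 n p) y * wt (fun _ => ε) m
        * (if gcross (fun a b : BoxV 3 n => if a.1 ∈ Icc 0 (cubeShape n) ∧ b.1 ∈ Icc 0 (cubeShape n) then latEdge 3 n a b else none)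
              {v : BoxV 3 n | v.1 ∈ Icc 0 (cubeShape n) ∧ v.1 0 = 0} {v : BoxV 3 n | v.1 ∈ Icc 0 (cubeShape n) ∧ v.1 0 = cubeShape n 0} x
            ≠ gcross (fun a b : BoxV 3 n => if a.1 ∈ Icc 0 (cubeShape n) ∧ b.1 ∈ Icc 0 (cubeShape n) then latEdge 3 n a b else none)
              {v : BoxV 3 n | v.1 ∈ Icc 0 (cubeShape n) ∧ v.1 0 = 0} {v : BoxV 3 n | v.1 ∈ Icc 0 (cubeShape n) ∧ v.1 0 = cubeShape n 0}
              (fun e => if m e = true then y e else x e) then (1 : ℝ) else 0)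
      ≤ 2 * ε * (((p : ℝ) * (1 - p)) * ∑ z ∈ (box 3 n).sym2, (bondPercolation (zdGraph 3) p).real
          {ω | z ∈ (zdGraph 3).edgeSet ∧ IsPivotal (boxCross (cubeShape n) 0) z ω}) :=
  boxCross_flip_le (cubeShape n) 0 n (Icc_cubeShape_subset_box n) p hε0 hε1

/-- **THE CUBE: NOISE BELOW `1/((n+1)√S_{n+1})` NEVER MATTERS** (`ℤ³`, every `n`, `p`, `0 ≤ ε ≤ 1`):
`P_p(𝟙_n(ω) ≠ 𝟙_n(ω^ε)) ≤ 2ε·(n+1)·√(24·S_{n+1}(p)·p(1−p)·Π_p(n)(1−Π_p(n)))` — in particular `≤ √6·ε·(n+1)^{3/2}` at every `p`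
(`S_{n+1} ≤ n+1`, `p(1−p), Π(1−Π) ≤ 1/4`). [cite: DewanMuirhead2022, Prop. 2.2] [cite: ODonnell2014, §2.4 Ex. 2.42] -/
theorem cube_flip_le_sqrt (n : ℕ) (p : unitInterval) {ε : ℝ} (hε0 : 0 ≤ ε) (hε1 : ε ≤ 1) :
    ∑ x : PairIdx 3 n → Bool, ∑ y : PairIdx 3 n → Bool, ∑ m : PairIdx 3 n → Bool,
        wt (boxBias 3 n p) x * wt (boxBias 3 n p) y * wt (fun _ => ε) m
        * (if gcross (fun a b : BoxV 3 n => if a.1 ∈ Icc 0 (cubeShape n) ∧ b.1 ∈ Icc 0 (cubeShape n) then latEdge 3 n a b else none)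
              {v : BoxV 3 n | v.1 ∈ Icc 0 (cubeShape n) ∧ v.1 0 = 0} {v : BoxV 3 n | v.1 ∈ Icc 0 (cubeShape n) ∧ v.1 0 = cubeShape n 0} x
            ≠ gcross (fun a b : BoxV 3 n => if a.1 ∈ Icc 0 (cubeShape n) ∧ b.1 ∈ Icc 0 (cubeShape n) then latEdge 3 n a b else none)
              {v : BoxV 3 n | v.1 ∈ Icc 0 (cubeShape n) ∧ v.1 0 = 0} {v : BoxV 3 n | v.1 ∈ Icc 0 (cubeShape n) ∧ v.1 0 = cubeShape n 0}
              (fun e => if m e = true then y e else x e) then (1 : ℝ) else 0)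
      ≤ 2 * ε * (((n : ℝ) + 1) * Real.sqrt (24 * (∑ j ∈ Finset.range (n + 1), oneArmProb 3 p j) * ((p : ℝ) * (1 - p))
          * (boxCrossProb 3 p (cubeShape n) 0 * (1 - boxCrossProb 3 p (cubeShape n) 0)))) := by
  have h := boxCross_flip_le_sqrt (cubeShape n) 0 n (Icc_cubeShape_subset_box n) p hε0 hε1
  rw [toNat_cubeShape_zero] at h
  refine h.trans (mul_le_mul_of_nonneg_left ?_ (by positivity))
  have hcard := card_Icc_cubeShape_le n
  set S : ℝ := ∑ j ∈ Finset.range (n + 1), oneArmProb 3 p j with hS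
  set V : ℝ := boxCrossProb 3 p (cubeShape n) 0 * (1 - boxCrossProb 3 p (cubeShape n) 0) with hV
  have hS0 : 0 ≤ S := Finset.sum_nonneg fun _ _ => measureReal_nonneg
  have hV0 : 0 ≤ V := mul_nonneg measureReal_nonneg (sub_nonneg.2 measureReal_le_one)
  have hq0 : 0 ≤ (p : ℝ) * (1 - p) := mul_nonneg p.2.1 (sub_nonneg.2 p.2.2)
  have hn : (0 : ℝ) < (n : ℝ) + 1 := by positivity
  have hcast : (((n + 1 : ℕ)) : ℝ) = (n : ℝ) + 1 := by push_cast; ring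
  rw [hcast]
  -- `√(8·3·#B·S·q·V/(n+1)) ≤ √(24(n+1)²·S·q·V) = (n+1)√(24 S q V)`
  have hin : 8 * (3 : ℕ) * ((Finset.Icc (0 : Site 3) (cubeShape n)).card : ℝ) * S * ((p : ℝ) * (1 - p)) * V / ((n : ℝ) + 1)
      ≤ ((n : ℝ) + 1) ^ 2 * (24 * S * ((p : ℝ) * (1 - p)) * V) := by
    rw [div_le_iff₀ hn]
    have : 8 * (3 : ℕ) * ((Finset.Icc (0 : Site 3) (cubeShape n)).card : ℝ) * S * ((p : ℝ) * (1 - p)) * V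
        ≤ 8 * 3 * ((n : ℝ) + 1) ^ 3 * S * ((p : ℝ) * (1 - p)) * V := by
      push_cast
      exact mul_le_mul_of_nonneg_right (mul_le_mul_of_nonneg_right (mul_le_mul_of_nonneg_right
        (mul_le_mul_of_nonneg_left hcard (by norm_num)) hS0) hq0) hV0
    refine this.trans (le_of_eq ?_)
    ring
  calc Real.sqrt (8 * (3 : ℕ) * ((Finset.Icc (0 : Site 3) (cubeShape n)).card : ℝ) * S * ((p : ℝ) * (1 - p)) * V / ((n : ℝ) + 1))
      ≤ Real.sqrt (((n : ℝ) + 1) ^ 2 * (24 * S * ((p : ℝ) * (1 - p)) * V)) := Real.sqrt_le_sqrt hin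
    _ = ((n : ℝ) + 1) * Real.sqrt (24 * S * ((p : ℝ) * (1 - p)) * V) := by
        rw [Real.sqrt_mul (sq_nonneg _), Real.sqrt_sq hn.le]

/-- **THE CUBE CROSSING IS NEARLY UNCORRELATED WITH EVERY WEIGHTED EDGE COUNT** (`ℤ³`, every `n`, `p`, every weight vector `a` on the pairs of
`Λ(n)`; `δ_n(p) = 4S_{n+1}(p)/(n+1)`): `|E_p[𝟙_n·Σ_e a_e(𝟙[ω_e] − b_e)]| ≤ √(δ_n(p)·Π_p(n))·√(Σ_e a_e² b_e(1−b_e))`.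
[cite: BenjaminiKalaiSchramm1999, §1.3 Thm 1.7] [cite: SchrammSteif2010, Thm 1.8] -/
theorem cube_abs_cov_linear_le (n : ℕ) (p : unitInterval) (a : PairIdx 3 n → ℝ) :
    |∑ x : PairIdx 3 n → Bool, wt (boxBias 3 n p) x * (gcross
          (fun a b : BoxV 3 n => if a.1 ∈ Icc 0 (cubeShape n) ∧ b.1 ∈ Icc 0 (cubeShape n) then latEdge 3 n a b else none)
          {v : BoxV 3 n | v.1 ∈ Icc 0 (cubeShape n) ∧ v.1 0 = 0} {v : BoxV 3 n | v.1 ∈ Icc 0 (cubeShape n) ∧ v.1 0 = cubeShape n 0} x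
        * ∑ e, a e * ctr (boxBias 3 n p) e x)|
      ≤ Real.sqrt ((4 * (∑ j ∈ Finset.range (n + 1), oneArmProb 3 p j) / ((n : ℝ) + 1)) * boxCrossProb 3 p (cubeShape n) 0)
        * Real.sqrt (∑ e, a e ^ 2 * (boxBias 3 n p e * (1 - boxBias 3 n p e))) := by
  have h := boxCross_abs_cov_linear_le (cubeShape n) 0 n (Icc_cubeShape_subset_box n) p a
  rw [toNat_cubeShape_zero] at h
  push_cast at h
  exact h

/-- **THE CUBE CROSSING IS NEARLY UNCORRELATED WITH EVERY LOCAL STATISTIC** (`ℤ³`, every `n`, `p`; every finite sum `G` of `k`-local functions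
of the pairs of `Λ(n)`): `|E_p[𝟙_n·G] − Π_p(n)·E_p[G]| ≤ k·√(δ_n(p)·Π_p(n))·√(Var_p G)`.
[cite: SchrammSteif2010, Thm 1.8] [cite: BenjaminiKalaiSchramm1999, Thm 1.9] -/
theorem cube_abs_cov_local_le (n : ℕ) (p : unitInterval) {τ : Type*} [Fintype τ] {k : ℕ} (M : τ → Finset (PairIdx 3 n))
    (hM : ∀ t, (M t).card ≤ k) (g : τ → (PairIdx 3 n → Bool) → ℝ) (hg : ∀ t x e c, e ∉ M t → g t (update x e c) = g t x) :
    |(∑ x : PairIdx 3 n → Bool, wt (boxBias 3 n p) x * (gcross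
          (fun a b : BoxV 3 n => if a.1 ∈ Icc 0 (cubeShape n) ∧ b.1 ∈ Icc 0 (cubeShape n) then latEdge 3 n a b else none)
          {v : BoxV 3 n | v.1 ∈ Icc 0 (cubeShape n) ∧ v.1 0 = 0} {v : BoxV 3 n | v.1 ∈ Icc 0 (cubeShape n) ∧ v.1 0 = cubeShape n 0} x
        * ∑ t, g t x))
        - boxCrossProb 3 p (cubeShape n) 0 * (∑ x : PairIdx 3 n → Bool, wt (boxBias 3 n p) x * ∑ t, g t x)|
      ≤ k * Real.sqrt ((4 * (∑ j ∈ Finset.range (n + 1), oneArmProb 3 p j) / ((n : ℝ) + 1)) * boxCrossProb 3 p (cubeShape n) 0)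
        * Real.sqrt ((∑ x : PairIdx 3 n → Bool, wt (boxBias 3 n p) x * ((∑ t, g t x) * ∑ t, g t x))
            - (∑ x : PairIdx 3 n → Bool, wt (boxBias 3 n p) x * ∑ t, g t x) ^ 2) := by
  have h := boxCross_abs_cov_local_le (cubeShape n) 0 n (Icc_cubeShape_subset_box n) p M hM g hg
  rw [toNat_cubeShape_zero] at h
  push_cast at h
  exact h

end Summit.CriticalPhenomena.PercolationContinuityZ3.Theorems.Crossing

end
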